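import Mathlib
import HarnessLib
import Summits.NavierStokesRegularity.NavierStokesRegularity.Theorems.PoloidalWindowDoorLrcModEntireThreadPins
import Summits.NavierStokesRegularity.NavierStokesRegularity.Theorems.PoloidalWindowDoorLrcModEntireThreadPressure

/-!
# Route `PoloidalWindowDoor`, item `LrcModEntire` (stmt-NavierStokesRegularity-20428) / crux K2 (stmt-19708) —
# the THREADED HOT SPOT, non-Morse branch: third- and fourth-order pins along a flat direction

LEAD of item 20428 ns-poloidal-K2-p3 g10 (`--supports stmt-NavierStokesRegularity-20428 --as helper`).
The thick column's stub S3 `stub_threadedThickEmpty` is split by the ideator line `thread_axis` into a MORSE branch (horizontal Hessian of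
`v₂(−1,·)` at the hot spot definite) and a NON-MORSE branch (a flat direction `e`: `D²v₂(−1,·)(0)[e,e] = 0`).  This file supplies the free
pins of the non-Morse branch: the one-variable HIGHER-ORDER MAXIMUM TEST (a `C³`/`C⁴` function with a local maximum at `0` and vanishing
second derivative has vanishing third derivative and non-positive fourth derivative — proved from the sign lemma
`eventually_nhdsWithin_sign_eq_of_deriv_pos` and the mean value theorem, no Taylor expansion), the identification of line derivatives
with diagonal Fréchet derivatives at every order, and the packaged pin `threadQuarticPin`:
at a threaded hot spot, along every flat direction `e`, `D³v₂(−1,·)(0)[e,e,e] = 0` and `v₂(−1,0) · D⁴v₂(−1,·)(0)[e,e,e,e] ≤ 0`.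
* `lt_of_deriv_pos_Ioo` — MVT engine; `iteratedDeriv_three_eq_zero_of_isLocalMax`, `iteratedDeriv_four_nonpos_of_isLocalMax` — the test;
* `iteratedDeriv_line_eq_iteratedFDeriv` — `dⁿ/dtⁿ f(t e)|₀ = Dⁿf(0)[e,…,e]`;
* `threadQuarticPin` — the pin in the class (hypotheses as in `threadHessianPin`).
WHAT THIS IS NOT: not the thick stub, not a claim about Navier–Stokes regularity — calculus at a hot spot (bears_on LADDER-NS N0,
rung N0-LocalTubeDoorPoloidal). [folklore]
-/

noncomputable section

-- the summit and its single sub-problem share the name (CONVENTIONS §1), as in every Theorems file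
set_option linter.dupNamespace false

namespace Summit.NavierStokesRegularity.NavierStokesRegularity.Theorems.PoloidalWindowDoorLrcModEntireThreadQuarticPin

open MeasureTheory Set Function Filter Topology
open scoped RealInnerProductSpace InnerProductSpace
open Literature.Analysis Literature.Analysis.FluidPDE Literature.Analysis.UnboundedOperators
open Summit.NavierStokesRegularity.NavierStokesRegularity.Theorems.LocalSineTubeDoorProfileAlignedWindowRigidityAncient

/-! ### One-variable higher-order maximum test -/

/-- MVT engine: a differentiable `f` with `f' > 0` on `(0, ε)` satisfies `f 0 < f x` for `x ∈ (0, ε)`. [folklore] -/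
theorem lt_of_deriv_pos_Ioo {f : ℝ → ℝ} (hf : Differentiable ℝ f) {ε : ℝ}
    (h : ∀ x : ℝ, 0 < x → x < ε → 0 < deriv f x) : ∀ x : ℝ, 0 < x → x < ε → f 0 < f x := by
  intro x hx hxε
  obtain ⟨c, hc, hcd⟩ := exists_deriv_eq_slope f hx hf.continuous.continuousOn hf.differentiableOn
  have h1 : 0 < deriv f c := h c hc.1 (hc.2.trans hxε)
  rw [hcd, sub_zero] at h1
  have h2 : 0 < f x - f 0 := (div_pos_iff_of_pos_right hx).1 h1
  linarith

/-- From a sign condition `sign (g x) = sign x` near `0` together with a local-max condition, extract a radius. -/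
private theorem radius_of_sign {g φ : ℝ → ℝ} (hsign : ∀ᶠ x in 𝓝 (0 : ℝ), SignType.sign (g x) = SignType.sign (x - 0))
    (hmax : IsLocalMax φ 0) :
    ∃ ε > 0, (∀ x : ℝ, 0 < x → x < ε → 0 < g x) ∧ φ (ε / 2) ≤ φ 0 := by
  obtain ⟨ε, hε, hball⟩ := Metric.eventually_nhds_iff.1 (hsign.and hmax)
  refine ⟨ε, hε, fun x hx0 hxε => ?_, ?_⟩
  · have hx : dist x 0 < ε := by rw [Real.dist_eq, sub_zero, abs_of_pos hx0]; exact hxε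
    have h := (hball hx).1
    rw [sub_zero, sign_pos hx0, sign_eq_one_iff] at h
    exact h
  · have hε2 : dist (ε / 2) 0 < ε := by rw [Real.dist_eq, sub_zero, abs_of_pos (by linarith)]; linarith
    exact (hball hε2).2

/-- Positive third derivative with vanishing second derivative is incompatible with a local maximum (one-sided version). -/
private theorem not_isLocalMax_of_iteratedDeriv_three_pos {φ : ℝ → ℝ} (hφ : ContDiff ℝ 3 φ) (hmax : IsLocalMax φ 0)
    (h2 : iteratedDeriv 2 φ 0 = 0) (h3 : 0 < iteratedDeriv 3 φ 0) : False := by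
  have hd0 : Differentiable ℝ φ := hφ.differentiable (by norm_num)
  have hd1 : Differentiable ℝ (iteratedDeriv 1 φ) := hφ.differentiable_iteratedDeriv 1 (by norm_num)
  have hd2 : Differentiable ℝ (iteratedDeriv 2 φ) := hφ.differentiable_iteratedDeriv 2 (by norm_num)
  have e3 : iteratedDeriv 3 φ = deriv (iteratedDeriv 2 φ) := iteratedDeriv_succ
  have e2 : iteratedDeriv 2 φ = deriv (iteratedDeriv 1 φ) := iteratedDeriv_succ
  have e1 : iteratedDeriv 1 φ = deriv φ := iteratedDeriv_one
  have hsign := eventually_nhdsWithin_sign_eq_of_deriv_pos (f := iteratedDeriv 2 φ) (x₀ := 0) (by rwa [← e3]) h2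
  obtain ⟨ε, hε, hpos2, hmaxε⟩ := radius_of_sign hsign hmax
  -- `φ'' > 0` on `(0,ε)` ⇒ `φ' > φ'(0) = 0` there ⇒ `φ > φ 0` there
  have hpos1 : ∀ x : ℝ, 0 < x → x < ε → 0 < iteratedDeriv 1 φ x := by
    intro x hx hxε
    have h := lt_of_deriv_pos_Ioo hd1 (fun y hy hyε => by rw [← e2]; exact hpos2 y hy hyε) x hx hxε
    have h0 : iteratedDeriv 1 φ 0 = 0 := by rw [e1]; exact hmax.deriv_eq_zero
    linarith
  have hpos0 := lt_of_deriv_pos_Ioo hd0 (fun y hy hyε => by rw [← e1]; exact hpos1 y hy hyε) (ε / 2) (by linarith)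
    (by linarith)
  linarith

/-- **Higher-order maximum test, third order.** A `C³` function with a local maximum at `0` and vanishing second derivative there has
vanishing third derivative there. [folklore] -/
theorem iteratedDeriv_three_eq_zero_of_isLocalMax {φ : ℝ → ℝ} (hφ : ContDiff ℝ 3 φ) (hmax : IsLocalMax φ 0)
    (h2 : iteratedDeriv 2 φ 0 = 0) : iteratedDeriv 3 φ 0 = 0 := by
  by_contra h3
  rcases lt_or_gt_of_ne h3 with hneg | hpos
  · -- reflect: `ψ x = φ (−x)` has a local max at `0`, `ψ'' (0) = 0`, `ψ'''(0) = −φ'''(0) > 0`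
    set ψ : ℝ → ℝ := fun x => φ (-x) with hψ
    have hψc : ContDiff ℝ 3 ψ := hφ.comp contDiff_neg
    have hψmax : IsLocalMax ψ 0 := by
      have h : IsLocalMax (φ ∘ Neg.neg) (0 : ℝ) :=
        IsLocalMax.comp_continuous (by simpa using hmax) continuous_neg.continuousAt
      exact h
    have hψ2 : iteratedDeriv 2 ψ 0 = 0 := by
      rw [hψ, iteratedDeriv_comp_neg 2 φ 0, neg_zero, h2, smul_zero]
    have hψ3 : 0 < iteratedDeriv 3 ψ 0 := by
      rw [hψ, iteratedDeriv_comp_neg 3 φ 0, neg_zero, smul_eq_mul]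
      norm_num
      linarith
    exact not_isLocalMax_of_iteratedDeriv_three_pos hψc hψmax hψ2 hψ3
  · exact not_isLocalMax_of_iteratedDeriv_three_pos hφ hmax h2 hpos

/-- **Higher-order maximum test, fourth order.** A `C⁴` function with a local maximum at `0` and vanishing second derivative there has
non-positive fourth derivative there. [folklore] -/
theorem iteratedDeriv_four_nonpos_of_isLocalMax {φ : ℝ → ℝ} (hφ : ContDiff ℝ 4 φ) (hmax : IsLocalMax φ 0)
    (h2 : iteratedDeriv 2 φ 0 = 0) : iteratedDeriv 4 φ 0 ≤ 0 := by
  by_contra h4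
  push Not at h4
  have h3 : iteratedDeriv 3 φ 0 = 0 := iteratedDeriv_three_eq_zero_of_isLocalMax (hφ.of_le (by norm_num)) hmax h2
  have hd0 : Differentiable ℝ φ := hφ.differentiable (by norm_num)
  have hd1 : Differentiable ℝ (iteratedDeriv 1 φ) := hφ.differentiable_iteratedDeriv 1 (by norm_num)
  have hd2 : Differentiable ℝ (iteratedDeriv 2 φ) := hφ.differentiable_iteratedDeriv 2 (by norm_num)
  have hd3 : Differentiable ℝ (iteratedDeriv 3 φ) := hφ.differentiable_iteratedDeriv 3 (by norm_num)
  have e4 : iteratedDeriv 4 φ = deriv (iteratedDeriv 3 φ) := iteratedDeriv_succ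
  have e3 : iteratedDeriv 3 φ = deriv (iteratedDeriv 2 φ) := iteratedDeriv_succ
  have e2 : iteratedDeriv 2 φ = deriv (iteratedDeriv 1 φ) := iteratedDeriv_succ
  have e1 : iteratedDeriv 1 φ = deriv φ := iteratedDeriv_one
  have hsign := eventually_nhdsWithin_sign_eq_of_deriv_pos (f := iteratedDeriv 3 φ) (x₀ := 0) (by rwa [← e4]) h3
  obtain ⟨ε, hε, hpos3, hmaxε⟩ := radius_of_sign hsign hmax
  have hpos2 : ∀ x : ℝ, 0 < x → x < ε → 0 < iteratedDeriv 2 φ x := by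
    intro x hx hxε
    have h := lt_of_deriv_pos_Ioo hd2 (fun y hy hyε => by rw [← e3]; exact hpos3 y hy hyε) x hx hxε
    linarith
  have hpos1 : ∀ x : ℝ, 0 < x → x < ε → 0 < iteratedDeriv 1 φ x := by
    intro x hx hxε
    have h := lt_of_deriv_pos_Ioo hd1 (fun y hy hyε => by rw [← e2]; exact hpos2 y hy hyε) x hx hxε
    have h0 : iteratedDeriv 1 φ 0 = 0 := by rw [e1]; exact hmax.deriv_eq_zero
    linarith
  have hpos0 := lt_of_deriv_pos_Ioo hd0 (fun y hy hyε => by rw [← e1]; exact hpos1 y hy hyε) (ε / 2) (by linarith)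
    (by linarith)
  linarith

/-! ### Line derivatives are diagonal Fréchet derivatives, every order -/

/-- `dⁿ/dtⁿ f(t • e)|_{t=0} = Dⁿf(0)[e,…,e]` for a `Cⁿ` function on `ℝ³`. [folklore] -/
theorem iteratedDeriv_line_eq_iteratedFDeriv {f : EuclideanSpace ℝ (Fin 3) → ℝ} {n : ℕ} (hf : ContDiff ℝ n f)
    (e : EuclideanSpace ℝ (Fin 3)) {k : ℕ} (hk : k ≤ n) :
    iteratedDeriv k (fun t : ℝ => f (t • e)) 0 = iteratedFDeriv ℝ k f 0 (fun _ => e) := by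
  set L : ℝ →L[ℝ] EuclideanSpace ℝ (Fin 3) := ContinuousLinearMap.toSpanSingleton ℝ e with hL
  have hfun : (fun t : ℝ => f (t • e)) = f ∘ L := by
    funext t; simp [hL, ContinuousLinearMap.toSpanSingleton_apply]
  rw [hfun, iteratedDeriv_eq_iteratedFDeriv, L.iteratedFDeriv_comp_right hf 0 (by exact_mod_cast hk),
    ContinuousMultilinearMap.compContinuousLinearMap_apply]
  simp [hL, ContinuousLinearMap.toSpanSingleton_apply]

/-! ### The quartic pin at a threaded hot spot -/

/-- **QUARTIC PIN along a flat direction (non-Morse branch of the thick column).**  For a profile of the class whose scale-invariant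
vertical size `√(−t)|v₂|` peaks at the hot spot `(−1,0)` with `v₂(−1,0) ≠ 0`, and a direction `e` in which the Hessian of `v₂(−1,·)`
at `0` is flat (`D²v₂(−1,·)(0)[e,e] = 0`): the third line derivative vanishes, `D³v₂(−1,·)(0)[e,e,e] = 0`, and the fourth is signed
against `v₂`, `v₂(−1,0) · D⁴v₂(−1,·)(0)[e,e,e,e] ≤ 0` (higher-order maximum test along the line `t ↦ t e`; `C⁴` from slice analyticity).
[folklore] -/
theorem threadQuarticPin {v : ℝ → EuclideanSpace ℝ (Fin 3) → EuclideanSpace ℝ (Fin 3)} {C : ℝ} (hrate : HasTypeITimeDecay C v)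
    (hcont : ContinuousOn (uncurry v) (Iio (0 : ℝ) ×ˢ univ))
    (hmild : ∀ s t : ℝ, s < t → t < 0 → ∀ x, v t x = heatExtension (v s) (t - s) x - oseenDuhamel 1 s v v t x)
    (hne : v (-1) 0 2 ≠ 0) (hhot : ∀ t < 0, ∀ x, Real.sqrt (-t) * |v t x 2| ≤ |v (-1) 0 2|) {e : EuclideanSpace ℝ (Fin 3)}
    (hflat : iteratedFDeriv ℝ 2 (fun y => v (-1) y 2) 0 (fun _ => e) = 0) :
    iteratedFDeriv ℝ 3 (fun y => v (-1) y 2) 0 (fun _ => e) = 0 ∧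
      v (-1) 0 2 * iteratedFDeriv ℝ 4 (fun y => v (-1) y 2) 0 (fun _ => e) ≤ 0 := by
  set f : EuclideanSpace ℝ (Fin 3) → ℝ := fun y => v (-1) y 2 with hf
  have hfa : ContDiff ℝ 4 f := by
    have hsl := analyticOnNhd_slice hcont (bdd_of_hasTypeITimeDecay hrate) hmild (by norm_num : (-1 : ℝ) < 0)
    have han : AnalyticOnNhd ℝ f univ := fun y _ =>
      ((EuclideanSpace.proj (𝕜 := ℝ) (2 : Fin 3)).analyticAt _).comp (hsl y (mem_univ _))
    exact han.contDiff
  obtain ⟨σ, hσabs, hσa⟩ : ∃ σ : ℝ, |σ| = 1 ∧ σ * v (-1) 0 2 = |v (-1) 0 2| := by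
    rcases lt_or_gt_of_ne hne with h | h
    · exact ⟨-1, by simp, by rw [abs_of_neg h]; ring⟩
    · exact ⟨1, by simp, by rw [abs_of_pos h]; ring⟩
  have hσle : ∀ y : ℝ, σ * y ≤ |y| := fun y =>
    calc σ * y ≤ |σ * y| := le_abs_self _
      _ = |y| := by rw [abs_mul, hσabs, one_mul]
  have hσ2 : σ * σ = 1 := by
    have h := congrArg (fun r : ℝ => r ^ 2) hσabs
    simp only [sq_abs, one_pow] at h
    nlinarith [h]
  have hσne : σ ≠ 0 := fun h => by rw [h, abs_zero] at hσabs; exact zero_ne_one hσabs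
  -- the line function `φ t = σ f(t e)` : `C⁴`, local max at `0`
  set g : ℝ → ℝ := fun t => f (t • e) with hg
  have hgc : ContDiff ℝ 4 g := hfa.comp (contDiff_id.smul contDiff_const)
  set φ : ℝ → ℝ := fun t => σ * g t with hφ
  have hφc : ContDiff ℝ 4 φ := contDiff_const.mul hgc
  have hmax : IsLocalMax φ 0 := by
    refine Filter.Eventually.of_forall fun t => ?_
    show σ * f (t • e) ≤ σ * f ((0 : ℝ) • e)
    simp only [zero_smul]
    have hh := hhot (-1) (by norm_num) (t • e)
    have hR : Real.sqrt (-(-1 : ℝ)) = 1 := by norm_num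
    rw [hR, one_mul] at hh
    calc σ * f (t • e) ≤ |f (t • e)| := hσle _
      _ ≤ |v (-1) 0 2| := hh
      _ = σ * f 0 := hσa.symm
  -- iterated derivatives of `φ` are `σ` times the diagonal Fréchet derivatives of `f`
  have hder : ∀ k : ℕ, k ≤ 4 → iteratedDeriv k φ 0 = σ * iteratedFDeriv ℝ k f 0 (fun _ => e) := by
    intro k hk
    have h1 : iteratedDeriv k φ 0 = σ * iteratedDeriv k g 0 := by
      have hφ' : φ = σ • g := by funext t; simp [hφ, smul_eq_mul]
      rw [hφ', iteratedDeriv_const_smul ((hgc.of_le (by exact_mod_cast hk)).contDiffAt) σ, smul_eq_mul]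
    rw [h1, hg, iteratedDeriv_line_eq_iteratedFDeriv hfa e hk]
  have h2 : iteratedDeriv 2 φ 0 = 0 := by rw [hder 2 (by norm_num), hflat, mul_zero]
  have h3 := iteratedDeriv_three_eq_zero_of_isLocalMax (hφc.of_le (by norm_num)) hmax h2
  have h4 := iteratedDeriv_four_nonpos_of_isLocalMax hφc hmax h2
  rw [hder 3 (by norm_num)] at h3
  rw [hder 4 (by norm_num)] at h4
  refine ⟨(mul_eq_zero.1 h3).resolve_left hσne, ?_⟩
  have haσ : v (-1) 0 2 = |v (-1) 0 2| * σ := by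
    calc v (-1) 0 2 = (σ * σ) * v (-1) 0 2 := by rw [hσ2, one_mul]
      _ = (σ * v (-1) 0 2) * σ := by ring
      _ = |v (-1) 0 2| * σ := by rw [hσa]
  rw [haσ, mul_assoc]
  exact mul_nonpos_of_nonneg_of_nonpos (abs_nonneg _) h4

/-! ### Appended (LEAD g10, 13:40Z): a flat direction lies in the kernel of the whole Hessian -/

/-- The constant `2`-tuple is the matrix literal. -/
theorem const_fin_two (e : EuclideanSpace ℝ (Fin 3)) : (fun _ : Fin 2 => e) = ![e, e] := by
  funext i; fin_cases i <;> simp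

/-- **Kernel of a semidefinite Hessian.**  If `f` is `C²`, `σ ≠ 0`, `σ · D²f(x)[w,w] ≤ 0` for every `w` and `D²f(x)[e,e] = 0`, then
`D²f(x)[e,w] = 0` for every `w` (symmetry of the second derivative + the quadratic inequality `2taσ + t²bσ ≤ 0 ∀ t`). [folklore] -/
theorem hessian_apply_eq_zero_of_flat {f : EuclideanSpace ℝ (Fin 3) → ℝ} (hf : ContDiff ℝ 2 f) {x : EuclideanSpace ℝ (Fin 3)}
    {σ : ℝ} (hσ : σ ≠ 0) (hsd : ∀ w : EuclideanSpace ℝ (Fin 3), σ * iteratedFDeriv ℝ 2 f x ![w, w] ≤ 0)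
    {e : EuclideanSpace ℝ (Fin 3)} (hflat : iteratedFDeriv ℝ 2 f x ![e, e] = 0) (w : EuclideanSpace ℝ (Fin 3)) :
    iteratedFDeriv ℝ 2 f x ![e, w] = 0 := by
  have hsymm : IsSymmSndFDerivAt ℝ f x := hf.contDiffAt.isSymmSndFDerivAt (by simp)
  set B : EuclideanSpace ℝ (Fin 3) →L[ℝ] EuclideanSpace ℝ (Fin 3) →L[ℝ] ℝ := fderiv ℝ (fderiv ℝ f) x with hB
  have hq : ∀ u u' : EuclideanSpace ℝ (Fin 3), iteratedFDeriv ℝ 2 f x ![u, u'] = B u u' := by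
    intro u u'; rw [iteratedFDeriv_two_apply]; simp [hB]
  have hee : B e e = 0 := by rw [← hq]; exact hflat
  have hwe : B w e = B e w := hsymm w e
  set a : ℝ := σ * B e w with ha
  set b : ℝ := σ * B w w with hb
  have hb0 : b ≤ 0 := by rw [hb, ← hq]; exact hsd w
  have key : ∀ t : ℝ, 2 * t * a + t ^ 2 * b ≤ 0 := by
    intro t
    have h := hsd (e + t • w)
    rw [hq] at h
    have hexp : B (e + t • w) (e + t • w) = B e e + t * B e w + t * B w e + t ^ 2 * B w w := by
      simp only [map_add, map_smul, add_apply, FunLike.coe_smul, Pi.smul_apply, smul_eq_mul]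
      ring
    rw [hexp, hee, hwe] at h
    have : σ * (0 + t * B e w + t * B e w + t ^ 2 * B w w) = 2 * t * a + t ^ 2 * b := by rw [ha, hb]; ring
    linarith [h, this]
  have h1b : 0 < 1 - b := by linarith
  have ht := key (a / (1 - b))
  have hid : 2 * (a / (1 - b)) * a + (a / (1 - b)) ^ 2 * b = a ^ 2 * ((2 - b) / (1 - b) ^ 2) := by
    field_simp
    ring
  rw [hid] at ht
  have hpos : 0 < (2 - b) / (1 - b) ^ 2 := by
    have : 0 < 2 - b := by linarith
    positivity
  have ha2 : a ^ 2 ≤ 0 := by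
    by_contra hh
    push Not at hh
    have := mul_pos hh hpos
    linarith
  have ha0 : a = 0 := pow_eq_zero_iff (two_ne_zero) |>.mp (le_antisymm ha2 (sq_nonneg a))
  rw [ha] at ha0
  rw [hq]
  exact (mul_eq_zero.1 ha0).resolve_left hσ

/-- **FLAT ⇒ KERNEL at a threaded hot spot.**  For a profile of the class whose scale-invariant vertical size peaks at `(−1,0)` with
`v₂(−1,0) ≠ 0`, a flat direction `e` of the Hessian of `v₂(−1,·)` at `0` (`D²v₂(−1,·)(0)[e,e] = 0`) is in the kernel of the WHOLE
Hessian: `D²v₂(−1,·)(0)[e,w] = 0` for every `w ∈ ℝ³` — in particular `∂_e∂_z v₂(−1,·)(0) = 0`, coupling horizontal flatness to the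
axial direction (the Hessian is semidefinite by `threadHessianPin`). [folklore] -/
theorem threadFlatKernel {v : ℝ → EuclideanSpace ℝ (Fin 3) → EuclideanSpace ℝ (Fin 3)} {C : ℝ} (hrate : HasTypeITimeDecay C v)
    (hcont : ContinuousOn (uncurry v) (Iio (0 : ℝ) ×ˢ univ))
    (hmild : ∀ s t : ℝ, s < t → t < 0 → ∀ x, v t x = heatExtension (v s) (t - s) x - oseenDuhamel 1 s v v t x)
    (hne : v (-1) 0 2 ≠ 0) (hhot : ∀ t < 0, ∀ x, Real.sqrt (-t) * |v t x 2| ≤ |v (-1) 0 2|) {e : EuclideanSpace ℝ (Fin 3)}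
    (hflat : iteratedFDeriv ℝ 2 (fun y => v (-1) y 2) 0 ![e, e] = 0) (w : EuclideanSpace ℝ (Fin 3)) :
    iteratedFDeriv ℝ 2 (fun y => v (-1) y 2) 0 ![e, w] = 0 := by
  have hfa : ContDiff ℝ 2 (fun y => v (-1) y 2) := by
    have hsl := analyticOnNhd_slice hcont (bdd_of_hasTypeITimeDecay hrate) hmild (by norm_num : (-1 : ℝ) < 0)
    have han : AnalyticOnNhd ℝ (fun y => v (-1) y 2) univ := fun y _ =>
      ((EuclideanSpace.proj (𝕜 := ℝ) (2 : Fin 3)).analyticAt _).comp (hsl y (mem_univ _))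
    exact han.contDiff
  exact hessian_apply_eq_zero_of_flat hfa hne
    (fun w => PoloidalWindowDoorLrcModEntireThreadPressure.threadHessianPin hrate hcont hmild hne hhot w) hflat w

/-- The two pins combined, for a flat direction stated in either tuple convention: kernel of the Hessian, vanishing third and signed
fourth line derivative. [folklore] -/
theorem threadFlatDirectionPins {v : ℝ → EuclideanSpace ℝ (Fin 3) → EuclideanSpace ℝ (Fin 3)} {C : ℝ}
    (hrate : HasTypeITimeDecay C v) (hcont : ContinuousOn (uncurry v) (Iio (0 : ℝ) ×ˢ univ))
    (hmild : ∀ s t : ℝ, s < t → t < 0 → ∀ x, v t x = heatExtension (v s) (t - s) x - oseenDuhamel 1 s v v t x)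
    (hne : v (-1) 0 2 ≠ 0) (hhot : ∀ t < 0, ∀ x, Real.sqrt (-t) * |v t x 2| ≤ |v (-1) 0 2|) {e : EuclideanSpace ℝ (Fin 3)}
    (hflat : iteratedFDeriv ℝ 2 (fun y => v (-1) y 2) 0 ![e, e] = 0) :
    (∀ w : EuclideanSpace ℝ (Fin 3), iteratedFDeriv ℝ 2 (fun y => v (-1) y 2) 0 ![e, w] = 0) ∧
      iteratedFDeriv ℝ 3 (fun y => v (-1) y 2) 0 (fun _ => e) = 0 ∧
      v (-1) 0 2 * iteratedFDeriv ℝ 4 (fun y => v (-1) y 2) 0 (fun _ => e) ≤ 0 := by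
  have hflat' : iteratedFDeriv ℝ 2 (fun y => v (-1) y 2) 0 (fun _ => e) = 0 := by rw [const_fin_two]; exact hflat
  exact ⟨threadFlatKernel hrate hcont hmild hne hhot hflat, threadQuarticPin hrate hcont hmild hne hhot hflat'⟩

end Summit.NavierStokesRegularity.NavierStokesRegularity.Theorems.PoloidalWindowDoorLrcModEntireThreadQuarticPin
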